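import Summits.QuantumAdvantage.QuantumAdvantage.Theorems.CubicForrelationNearExactIsExactSixChecker

/-!
# Crux `CubicForrelation.NearExactIsExact` (stmt-QuantumAdvantage-14043) — a verified HAMMING-DISTANCE certificate
  against `RM(3,n)` and the `RM(4,6)`-coset fact `dist(ω₆⁽²⁾, RM(3,6)) = 8`

Certificate seat `b2b-cforr-cert` (gen 10).  HONEST FRAMING: a finite brick (a decidable verdict about one coset of
`RM(3,6)`), NOT summit progress.  It is the input that the paper kill of the type-O branch of rank `≥ 6` at the second
boundary `n = 14` asks for (cert seat gen 9, `PROOF-N14-SECOND.md`, "rank d₁ ≥ 8 is impossible … Formalising needs the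
RM(4,6) coset fact"): for the standard symplectic form `ω₆ = x₀x₁ ⊕ x₂x₃ ⊕ x₄x₅` with Pfaffian square
`ω₆⁽²⁾ = x₀x₁x₂x₃ ⊕ x₀x₁x₄x₅ ⊕ x₂x₃x₄x₅` (`cw_pf2`), EVERY cubic `c : 𝔽₂⁶ → 𝔽₂` differs from `ω₆⁽²⁾` in at least `8`
points (`quarticCoset_six_ge_eight`), and `8` is attained by `c = x₀x₁x₃` (`quarticCoset_six_attained`); i.e. the
coset `ω₆⁽²⁾ + RM(3,6) ⊂ RM(4,6)` has minimum weight exactly `8` (`= 2·d(RM(4,6))`).  (Outside Lean, seat folder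
`work/c2/coset46.c`: the coset has `2 304` words of weight `8`, all of them affine frames `{a, a⊕b₁, …, a⊕b₆, a⊕Σbᵢ}`.)

THE CERTIFICATE (`cw_check`, sound by `cw_check_sound`; generic in `n ≥ 6`, the target `Q` and the radius `t = ks + kl`):
`f` cubic ⇒ the `RM(2,n)`-syndrome of `f` vanishes (part 1, `sy_synd_cubic`), so the mismatch set `M = {Q ≠ f}` has
the syndrome of `Q`; if `|M| ≤ t`, split `M` (sorted) into a light part of `≤ ks` codes (enumerated: all increasing
sublists of `range 2ⁿ` of length `≤ ks`, `cw_subsets`) and a heavy part of `≤ kl` codes (looked up in a complete table of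
column-XORs of all sublists of length `≤ kl`, `cw_table` / run-time completeness `cw_tableOK`); the certificate checks
that every such combination has total length `> t`.  Here `n = 6`, `t = 7 = 3 + 4` (`679 121` table entries,
`43 745` look-ups; `native_decide`, the file is `computational`).

References: F. J. MacWilliams, N. J. A. Sloane, *The Theory of Error-Correcting Codes* (1977) Ch. 13 §3–§5 (`RM(r,m)^⊥ =
RM(m−r−1,m)`, cosets of Reed–Muller codes); C. Carlet, *Boolean Functions for Cryptography and Coding Theory* (CUP 2021)
§4.1.  Everything below is proved from the tree.
-/

set_option linter.dupNamespace false -- D-0017: single-problem summit ⇒ `QuantumAdvantage.QuantumAdvantage` by design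

namespace Summit.QuantumAdvantage.QuantumAdvantage.Theorems.CubicForrelation.NearExactIsExact

open Finset
open Literature.Computability.QuantumComplexity
open Summit.QuantumAdvantage.QuantumAdvantage.Theorems.SignedExactSliceIsLift.StubMoebius (isDegLeFun_xor isDegLeFun_and)
open Summit.QuantumAdvantage.QuantumAdvantage.Theorems.NearExactIsExact.Negative.SmallCases (pt sum_pt)

/-! ### Sublists of bounded length and the look-up table -/

/-- All increasing sublists of `L` of length `≤ k`. -/
def cw_subsets : ℕ → List ℕ → List (List ℕ)
  | _, [] => [[]]
  | 0, _ :: _ => [[]]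
  | k + 1, a :: L => cw_subsets (k + 1) L ++ (cw_subsets k L).map (a :: ·)

/-- `[]` is always listed. [folklore] -/
theorem cw_nil_mem_subsets : ∀ (k : ℕ) (L : List ℕ), [] ∈ cw_subsets k L
  | _, [] => by simp [cw_subsets]
  | 0, _ :: _ => by simp [cw_subsets]
  | k + 1, a :: L => by
    rw [cw_subsets]
    exact List.mem_append_left _ (cw_nil_mem_subsets (k + 1) L)

/-- **Completeness**: every sublist of length `≤ k` is listed. [folklore] -/
theorem cw_mem_subsets {M L : List ℕ} (h : M.Sublist L) : ∀ {k : ℕ}, M.length ≤ k → M ∈ cw_subsets k L := by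
  induction h with
  | slnil => intro k _; exact cw_nil_mem_subsets k []
  | @cons M L a _ ih =>
    intro k hk
    cases k with
    | zero =>
      have : M = [] := List.eq_nil_of_length_eq_zero (Nat.le_zero.1 hk)
      subst this; simp [cw_subsets]
    | succ k =>
      rw [cw_subsets]
      exact List.mem_append_left _ (ih hk)
  | @cons_cons M L a _ ih =>
    intro k hk
    cases k with
    | zero => simp at hk
    | succ k =>
      rw [cw_subsets]
      refine List.mem_append_right _ (List.mem_map.2 ⟨M, ih (by simpa using hk), rfl⟩)

/-- The LOOK-UP TABLE: at index `t`, the recorded sublists (length `≤ kl`) with column-XOR `t`. -/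
def cw_table (nbits kl : ℕ) (cols : Array ℕ) (L : List ℕ) : Array (List (List ℕ)) :=
  (cw_subsets kl L).foldl (fun arr h => arr.modify (sy_xorCols (ck_aget cols) h) fun ls => h :: ls)
    (Array.replicate (2 ^ nbits) [])

/-- Run-time completeness check of the look-up table. -/
def cw_tableOK (kl : ℕ) (cols : Array ℕ) (L : List ℕ) (tab : Array (List (List ℕ))) : Bool :=
  (cw_subsets kl L).all fun h => (ck_pget tab (sy_xorCols (ck_aget cols) h)).contains h

/-- A checked table is complete. [folklore] -/
theorem cw_tableOK_spec {kl : ℕ} {cols : Array ℕ} {L : List ℕ} {tab : Array (List (List ℕ))}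
    (h : cw_tableOK kl cols L tab = true) : ∀ h' ∈ cw_subsets kl L, h' ∈ ck_pget tab (sy_xorCols (ck_aget cols) h') := by
  intro h' hh'
  simp only [cw_tableOK, List.all_eq_true] at h
  exact List.contains_iff_mem.1 (h h' hh')

/-! ### The certificate and its soundness -/

/-- **The Hamming-distance certificate**: no sublist `h` of `range 2ⁿ` of length `≤ ks` and no recorded sublist `h'` at
index `synd(Q) ⊕ xorCols(h)` have total length `≤ t`. -/
def cw_check (n ks t : ℕ) (cols : Array ℕ) (tab : Array (List (List ℕ))) (q : ℕ → Bool) : Bool :=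
  let S := sy_synd (ck_aget cols) q (List.range (2 ^ n))
  (cw_subsets ks (List.range (2 ^ n))).all fun h =>
    (ck_pget tab (S ^^^ sy_xorCols (ck_aget cols) h)).all fun h' => decide (t < h.length + h'.length)

/-- **Soundness of the Hamming-distance certificate** (`n ≥ 6`, correct columns, complete table for length `≤ kl`,
`t = ks + kl`): every cubic `f` differs from `Q` in more than `t` points. [this work] -/
theorem cw_check_sound {n ks kl t : ℕ} (hn : 6 ≤ n) (ht : t = ks + kl) {cols : Array ℕ}
    (hcols : ∀ k, k < 2 ^ n → ck_aget cols k = sy_col n k) {tab : Array (List (List ℕ))}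
    (htab : ∀ h' ∈ cw_subsets kl (List.range (2 ^ n)), h' ∈ ck_pget tab (sy_xorCols (ck_aget cols) h'))
    (Q : (Fin n → Bool) → Bool) (hc : cw_check n ks t cols tab (fun k => Q (pt n k)) = true)
    (f : (Fin n → Bool) → Bool) (hf : IsDegLeFun 3 f) :
    t < (univ.filter fun x => Q x ≠ f x).card := by
  set N := 2 ^ n with hN
  set q : ℕ → Bool := fun k => Q (pt n k) with hq
  set s : ℕ → Bool := fun k => f (pt n k) with hs
  set p : ℕ → Bool := fun k => xor (q k) (s k) with hp
  set M := (List.range N).filter p with hM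
  -- the cardinality is the length of `M`
  have hcard : (univ.filter fun x => Q x ≠ f x).card = M.length := by
    rw [hM, sy_length_filter_range, ← sum_pt n (fun x => if (xor (Q x) (f x)) = true then 1 else 0),
      Finset.card_filter]
    refine sum_congr rfl fun x _ => ?_
    cases Q x <;> cases f x <;> simp
  rw [hcard]
  by_contra hle
  rw [not_lt] at hle
  -- the syndrome of `M` is the syndrome of `Q`
  set S := sy_synd (ck_aget cols) q (List.range N) with hS
  have hsyn0 : sy_synd (ck_aget cols) s (List.range N) = 0 := sy_synd_cubic hn _ hcols f hf
  have hsynM : sy_xorCols (ck_aget cols) M = S := by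
    rw [hM, ← sy_synd_eq_xorCols, hp, sy_synd_bxor, hsyn0, hS, Nat.xor_zero]
  -- split `M`
  have hMsub : M.Sublist (List.range N) := by rw [hM]; exact List.filter_sublist
  set j := M.length - kl with hj
  set h₁ := M.take j with hh₁
  set h₂ := M.drop j with hh₂
  have hsplit : h₁ ++ h₂ = M := List.take_append_drop j M
  have hlen₁ : h₁.length ≤ ks := by rw [hh₁, List.length_take]; omega
  have hlen₂ : h₂.length ≤ kl := by rw [hh₂, List.length_drop]; omega
  have hmem₁ : h₁ ∈ cw_subsets ks (List.range N) :=
    cw_mem_subsets ((List.take_sublist j M).trans hMsub) hlen₁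
  have hmem₂ : h₂ ∈ ck_pget tab (sy_xorCols (ck_aget cols) h₂) :=
    htab h₂ (cw_mem_subsets ((List.drop_sublist j M).trans hMsub) hlen₂)
  have hx : S ^^^ sy_xorCols (ck_aget cols) h₁ = sy_xorCols (ck_aget cols) h₂ := by
    rw [← hsynM, ← hsplit, sy_xorCols_append, Nat.xor_comm, ← Nat.xor_assoc, Nat.xor_self, Nat.zero_xor]
  simp only [cw_check, List.all_eq_true, decide_eq_true_eq] at hc
  have hfin := hc h₁ hmem₁ h₂ (by rw [← hS, hx]; exact hmem₂)
  have hlenM : h₁.length + h₂.length = M.length := by rw [← List.length_append, hsplit]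
  omega

/-- **The packaged certificate** (columns + table built and checked at run time). -/
def cw_certify (n ks kl : ℕ) (q : ℕ → Bool) : Bool :=
  let N := 2 ^ n
  let cols := ck_cols n
  let tab := cw_table (sy_mons2 n).length kl cols (List.range N)
  ck_colsOK n cols && cw_tableOK kl cols (List.range N) tab && cw_check n ks (ks + kl) cols tab q

/-- **Soundness of the packaged certificate.** [this work] -/
theorem cw_certify_sound {n ks kl : ℕ} (hn : 6 ≤ n) (Q : (Fin n → Bool) → Bool)
    (h : cw_certify n ks kl (fun k => Q (pt n k)) = true) (f : (Fin n → Bool) → Bool) (hf : IsDegLeFun 3 f) :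
    ks + kl < (univ.filter fun x => Q x ≠ f x).card := by
  simp only [cw_certify, Bool.and_eq_true] at h
  obtain ⟨⟨hcols, htab⟩, hc⟩ := h
  exact cw_check_sound hn rfl (ck_colsOK_spec hcols) (cw_tableOK_spec htab) Q hc f hf

/-! ### The instance: the coset `ω₆⁽²⁾ + RM(3,6)` has minimum weight `8` -/

/-- `ω₆⁽²⁾ = x₀x₁x₂x₃ ⊕ x₀x₁x₄x₅ ⊕ x₂x₃x₄x₅`, the Pfaffian square of the standard symplectic form `x₀x₁ ⊕ x₂x₃ ⊕ x₄x₅`. -/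
def cw_pf2 (x : Fin 6 → Bool) : Bool :=
  xor (xor (x 0 && x 1 && x 2 && x 3) (x 0 && x 1 && x 4 && x 5)) (x 2 && x 3 && x 4 && x 5)

/-- **The certificate for `ω₆⁽²⁾` at radius `7 = 3 + 4`.** -/
theorem cw_certify_pf2 : cw_certify 6 3 4 (fun k => cw_pf2 (pt 6 k)) = true := by native_decide

/-- **`dist(ω₆⁽²⁾, RM(3,6)) ≥ 8`**: every cubic `c : 𝔽₂⁶ → 𝔽₂` differs from `ω₆⁽²⁾` in at least `8` points; i.e. the coset
`ω₆⁽²⁾ + RM(3,6) ⊂ RM(4,6)` has minimum weight `≥ 8 = 2·d(RM(4,6))`. [this work] -/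
theorem quarticCoset_six_ge_eight (c : (Fin 6 → Bool) → Bool) (hc : IsDegLeFun 3 c) :
    8 ≤ (univ.filter fun x => cw_pf2 x ≠ c x).card :=
  cw_certify_sound (by norm_num) cw_pf2 cw_certify_pf2 c hc

/-- **… and `8` is attained**: `ω₆⁽²⁾ ⊕ x₀x₁x₃` has weight `8` (its support is the affine frame
`{0b, 1b, 2b, 33, 37, 3c, 3d, 3e}` in code notation). [this work] -/
theorem quarticCoset_six_attained :
    (univ.filter fun x : Fin 6 → Bool => cw_pf2 x ≠ (x 0 && x 1 && x 3)).card = 8 := by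
  decide

/-- `x₀x₁x₃` is cubic. [cite: Carlet2020, §2.2.1 Def. 6] -/
theorem isDegLeFun_x013 : IsDegLeFun 3 (fun x : Fin 6 → Bool => (x 0 && x 1 && x 3)) :=
  (isDegLeFun_and (isDegLeFun_and (isDegLeFun_apply (0 : Fin 6) (le_refl 1)) (isDegLeFun_apply (1 : Fin 6) (le_refl 1)))
    (isDegLeFun_apply (3 : Fin 6) (le_refl 1))).mono (by norm_num)

/-- **The coset minimum weight is exactly `8`** (`IsLeast` over cubic `c`). [this work] -/
theorem quarticCoset_six_isLeast :
    IsLeast {w : ℕ | ∃ c : (Fin 6 → Bool) → Bool, IsDegLeFun 3 c ∧ (univ.filter fun x => cw_pf2 x ≠ c x).card = w} 8 := by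
  refine ⟨⟨_, isDegLeFun_x013, quarticCoset_six_attained⟩, ?_⟩
  rintro w ⟨c, hc, rfl⟩
  exact quarticCoset_six_ge_eight c hc

end Summit.QuantumAdvantage.QuantumAdvantage.Theorems.CubicForrelation.NearExactIsExact
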